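import Literature.Probability.FitznerVanDerHofstad2017.NobleBlocksDoublePrime
import Literature.Probability.FitznerVanDerHofstad2017.NobleBoundsN1IotaCls02
import Literature.Probability.FitznerVanDerHofstad2017.NobleBoundsN1Class00
import Literature.Probability.FitznerVanDerHofstad2017.NobleBoundsN1IotaCls22
import HarnessLib

/-!
# Fitzner–van der Hofstad (2017), §6.1: the class `(a,b) = (0,2)` of (6.4) at `N = 1` with the REPULSIVE middle letter

[FvdH17] = R. Fitzner, R. van der Hofstad, *Mean-field behavior for nearest-neighbor percolation in `d > 10`*,
Electron. J. Probab. **22** (2017), no. 43, arXiv:1506.07977v2; §6.1 proof of Lemma 5.3, "Case `a = 0, b ≥ 2`"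
(p. 59, source l.9918–9922): "We note that `u = w ≠ t, z` and obtain `𝓣_{1,1̲,0}(u−z, u+e_ι−z, t−z) ≤ Ā^{ι,0,2}(u,u,z,t)`".

The landed class estimates `NobleBoundsN1Cls02.jointWit_cls_zero_two` / `NobleBoundsN1IotaCls02.jointWitIota_cls_zero_two`
bound the middle piece by the App.-B-typed row `Ā'^{ι,0,2} = δ 𝓣*_{1,1̲,0}` (scalar style: the bond factor `p` times the
marginals of `{v↔t}₁`, `{z ←1→ u}₀`).  This module RE-PROVES the class `(0,2)` — plain and `ι` — with the REPULSIVE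
`𝓣_{1,1̲,0}` that §6.1 actually derives, i.e. against the additive family `NobleBlocks.blockAbar''` of
`NobleBlocksDoublePrime` (row `(0,2)` = `δ_{w,u} 𝓣_{1,1̲,0}(−(z−u), e_ι−(z−u), t−u−(z−u))`, `blockAbar''_zero_two`).

Why the repulsive letter is a theorem of the SAME two-level event: `jointWit` reads level `0` through
`offBonds {b₀} (ω 0)`, `b₀ = (u,v)` (every level-`0` witness avoids the pivotal bond; `eraseAt0_preimage_jointWit_inter_clsSet`),
so `p · ℙ^{⊗2}(jointWit ∩ class) = ℙ^{⊗2}({b₀ ∈ ω₀} ∩ jointWit ∩ class)` (`ofReal_mul_piPerc_preimage_eraseAt0`) and the three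
middle lines `{z ←1→ u}₀, {u ←1̲→ v}₀, {v ←0→ t}₁` are witnessed DISJOINTLY (pool `![K₀ 0, K₀ 1, K₀ 3, {b₀}]` on level `0`,
the repulsive `K₁ 0` on level `1`); grouped BK (`piPerc_genDisjOccGrouped_tag3_le`) and `piPerc_two_genDisjOcc_le_T` give
`𝓣_{1,1̲,0}(u−z, v−z, t−z)`.  The plain case follows the skeleton of `NobleBoundsN1Class00.jointWit_cls_0_0` with the right
group of class `b = 2` (`mem_openConnGe_two_of_notMem`, `piPerc_end_two_le_blockPE`); the `ι` case is the absorbed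
`piPerc_inter_le_prod₃_of_witnessedι₀` (grouping `grpιI₀`) on the part-`I` lines of `NobleBoundsN1IotaCls02` (part `II`
does not meet class `a = 0`).  Statements are given twice: with the middle factor written out (`…_abs`) and against
`blockAbar''` (`…''`, one `simp_rw [blockAbar''_zero_two]` away).  Unconditional, every `d` and `p`; nothing about the landed
`Ā'` statements is used or changed.
-/

noncomputable section

namespace Literature.Probability.FitznerVanDerHofstad2017
open scoped ENNReal BigOperators
open Literature.Barriers.CriticalPhenomena Literature.Probability.LatticeModels Literature.Probability.Percolation MeasureTheory
open Literature.Probability.FitznerVanDerHofstad2017.NobleBlocks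
open Literature.Probability.FitznerVanDerHofstad2017.NobleBlocks.LenIdx
variable {d : ℕ} (p : unitInterval)

/-! ## A. The middle piece and the bookkeeping -/

/-- **The middle piece, repulsive**: `ℙ^{⊗2}({z ←1→ u}_{c₀} ⊛ {u ←1̲→ v}_{c₁} ⊛ {v ←0→ t}_{c₂}) ≤ 𝓣_{1,1̲,0}(u−z, v−z, t−z)`
for every configuration assignment `c` (the object §6.1 produces at `(a,b) = (0,2)`).
[cite: FitznerVanDerHofstad2017, §6.1 proof of Lemma 5.3, "Case a = 0, b ≥ 2" (arXiv:1506.07977v2 p. 59)] -/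
theorem piPerc_mid_zero_two_abs_le_T (u v t z : Site d) (c : Fin 3 → Fin 2) :
    piPerc d p 2 (genDisjOcc ![event (ge 1) z u, event (eq 1) u v, event (ge 0) v t] c) ≤
      (Letters.perc d p).T (ge 1) (eq 1) (ge 0) (u - z) (v - z) (t - z) :=
  piPerc_two_genDisjOcc_le_T p (ge 1) (eq 1) (ge 0) z u v t c

/-- Bookkeeping of the regrouping for the class `(0,2)` in absorbed style: LEFT `![{0↔u}₀, {0↔w}₀]`, MIDDLE
`![{z ←1→ u}₀, {u ←1̲→ v}₀, {v ←0→ t}₁]`, RIGHT `![{x ←1→ t}₁, {t ←2→ z}₁, {z ←1→ x}₁]`; pools: level `0` =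
`![K₀ 0, K₀ 1, K₀ 3, {b₀}]`, repulsive level `1` = `![K₁ 0]`, free level `1` = `![K₁ 1, K₁ 2, K₁ 3]`. [folklore] -/
def src02 : Fin 2 ⊕ (Fin 3 ⊕ Fin 3) → Fin 4 ⊕ (Fin 1 ⊕ Fin 3) :=
  Sum.elim ![Sum.inl 0, Sum.inl 1]
    (Sum.elim ![Sum.inl 2, Sum.inl 3, Sum.inr (Sum.inl 0)]
      ![Sum.inr (Sum.inr 1), Sum.inr (Sum.inr 0), Sum.inr (Sum.inr 2)])

/-- The fold of the `(0,2)` row of `Ā''` in the live configuration `w = u`, `v = u + e_ι`: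
`δ_{u,u} 𝓣_{1,1̲,0}(−(z−u), e_ι−(z−u), t−u−(z−u)) = 𝓣_{1,1̲,0}(u−z, v−z, t−z)` — the argument triple printed in
§6.1 "Case `a = 0, b ≥ 2`": "`𝓣_{1,1̲,0}(u−z, u+e_ι−z, t−z) ≤ Ā^{ι,0,2}(u,u,z,t)`".
[cite: FitznerVanDerHofstad2017, §6.1 proof of Lemma 5.3, "Case a = 0, b ≥ 2" (arXiv:1506.07977v2 p. 59)] -/
theorem mid_fold (ι : Fin d × Bool) {u v : Site d} (hv : v = u + stepVec ι) (t z : Site d) :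
    kd (u - u) 0 * (Letters.perc d p).T (ge 1) (eq 1) (ge 0) (-(z - u)) (stepVec ι - (z - u)) (t - u - (z - u)) =
      (Letters.perc d p).T (ge 1) (eq 1) (ge 0) (u - z) (v - z) (t - z) := by
  have e1 : -(z - u) = u - z := neg_sub z u
  have e2 : stepVec ι - (z - u) = u + stepVec ι - z := by abel
  have e3 : t - u - (z - u) = t - z := by abel
  rw [sub_self, kd_self, one_mul, e1, e2, e3, hv]

/-- The middle piece against the written-out row `(0,2)` of `Ā''` (`= blockAbar'' (Letters.perc d p) ι 0 2 u w t z` by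
`NobleBlocks.blockAbar''_zero_two`). [cite: FitznerVanDerHofstad2017, §6.1 proof of Lemma 5.3, "Case a = 0, b ≥ 2" (arXiv:1506.07977v2 p. 59)] -/
theorem piPerc_mid_zero_two_abs_le {ι : Fin d × Bool} {u v w t z : Site d} (hv : v = u + stepVec ι)
    (hw : w = u) (c : Fin 3 → Fin 2) :
    piPerc d p 2 (genDisjOcc ![event (ge 1) z u, event (eq 1) u v, event (ge 0) v t] c) ≤
      kd (w - u) 0 * (Letters.perc d p).T (ge 1) (eq 1) (ge 0) (-(z - u)) (stepVec ι - (z - u)) (t - u - (z - u)) := by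
  subst hw
  rw [mid_fold p ι hv]
  exact piPerc_mid_zero_two_abs_le_T p w v t z c

/-- **[FvdH17] §6.1, class `(a,b) = (0,2)` of (6.4) at `N = 1`, with the REPULSIVE middle letter** (absorbed
style; middle factor written out, see `jointWit_cls_zero_two''` for the `Ā''` form):
`J(v−u) ℙ_p^{⊗2}(jointWit ∩ class (0,2)) ≤ Σ_ι 𝟙{v = u+e_ι} P^{S,0}(u,w) · δ_{w,u} 𝓣_{1,1̲,0}(−(z−u), e_ι−(z−u), t−u−(z−u)) · P^{E,2}(t−x,z−x)`.
Skeleton of `NobleBoundsN1Class00.jointWit_cls_0_0` (absorb `p` as the open bond `b₀`, which no witness uses;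
`mem_genDisjOccGrouped_of_pools₃`; grouped BK) with the right group of class `b = 2`.
[cite: FitznerVanDerHofstad2017, §6.1 proof of Lemma 5.3, "Case a = 0, b ≥ 2" (arXiv:1506.07977v2 p. 59)]
[cite: FitznerVanDerHofstad2017, §6.1 (6.4) and the sentence after it (arXiv:1506.07977v2 p. 58)] -/
theorem jointWit_cls_zero_two_abs (x u v w z t : Site d) :
    ENNReal.ofReal (bondJ d p (v - u)) * piPerc d p 2 (jointWit u v w z t x ∩ clsSet u w t z 0 2) ≤
      ∑ ι : Fin d × Bool, (if v = u + stepVec ι then (1 : ℝ≥0∞) else 0) *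
        (blockPS (Letters.perc d p) 0 u w *
          (kd (w - u) 0 * (Letters.perc d p).T (ge 1) (eq 1) (ge 0) (-(z - u)) (stepVec ι - (z - u)) (t - u - (z - u))) *
          blockPE (Letters.perc d p) 2 (t - x) (z - x)) := by
  classical
  set F := jointWit u v w z t x ∩ clsSet u w t z 0 2 with hF
  -- the bond factor `J(v - u)`
  by_cases hadj : (zdGraph d).Adj 0 (v - u)
  swap
  · rw [ofReal_bondJ_eq_zero_of_not_adj p hadj, zero_mul]; exact zero_le
  obtain ⟨ι₀, hι₀⟩ := (zdGraph_adj_iff_stepVec 0 (v - u)).1 hadj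
  have hv : v = u + stepVec ι₀ := by rw [zero_add] at hι₀; exact sub_eq_iff_eq_add'.1 hι₀
  have huv : u ≠ v := by rintro rfl; rw [sub_self] at hadj; exact hadj.ne rfl
  have he : s(u, v) ∈ (zdGraph d).edgeSet :=
    (SimpleGraph.mem_edgeSet _).2 ((zdGraph_adj_iff_stepVec u v).2 ⟨ι₀, hv⟩)
  rw [bondJ_def, if_pos hadj]
  -- an empty class contributes nothing; otherwise read off the side conditions
  by_cases hne : F.Nonempty
  swap
  · rw [Set.not_nonempty_iff_eq_empty.1 hne, measure_empty, mul_zero]; exact zero_le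
  obtain ⟨ω₀, hjw₀, hcls₀⟩ := hne
  obtain ⟨⟨-, hzx', -, -, -, hzu, -⟩, -⟩ := (mem_jointWit_iff u v w z t x ω₀).1 hjw₀
  have hwu : u = w := (mem_lineCls_zero_iff u w 0 ω₀).1 hcls₀.1
  have htz : t ≠ z := ((mem_lineCls_two_iff t z 1 ω₀).1 hcls₀.2).1
  have htx : t ≠ x := fun h => htz (h.trans (hzx'.2 h).symm)
  have hzx : z ≠ x := fun h => htz ((hzx'.1 h).trans h.symm)
  have hxt : x ≠ t := fun h => htx h.symm
  -- the `ι`-sum is at least its `ι₀` term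
  refine le_trans ?_ (term_le_sum_ite ι₀ hv _)
  -- absorb `p` as the open bond `b₀` on level `0`
  have hFm : MeasurableSet F := (measurableSet_jointWit u v w z t x).inter (measurableSet_clsSet u w t z 0 2)
  have habs := ofReal_mul_piPerc_preimage_eraseAt0 p he hFm
  rw [hF, eraseAt0_preimage_jointWit_inter_clsSet, ← hF] at habs
  rw [habs]
  -- the regrouped line families
  set AS : Fin 2 → Set (BondConfig (Site d)) := ![event (ge 0) 0 u, event (ge 0) 0 u] with hAS
  set AM : Fin 3 → Set (BondConfig (Site d)) := ![event (ge 1) z u, event (eq 1) u v, event (ge 0) v t] with hAM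
  set AE : Fin 3 → Set (BondConfig (Site d)) := ![event (ge 1) x t, event (ge 2) t z, event (ge 1) z x] with hAE
  set cS : Fin 2 → Fin 2 := ![0, 0] with hcS
  set cM : Fin 3 → Fin 2 := ![0, 0, 1] with hcM
  set cE : Fin 3 → Fin 2 := ![1, 1, 1] with hcE
  -- witness-level inclusion into the grouped event
  have hincl : {ω : Fin 2 → BondConfig (Site d) | s(u, v) ∈ ω 0} ∩ F ⊆
      genDisjOccGrouped (Sum.elim AS (Sum.elim AM AE)) (Sum.elim cS (Sum.elim cM cE)) tag3 := by
    rintro ω ⟨hb0, hjw, hcls⟩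
    obtain ⟨-, K₀, K₁, h₀, h₁, hA₀, hA₁, hd₀, hd₁, hc₀, -, -⟩ := (mem_jointWit_iff u v w z t x ω).1 hjw
    have hclosed : s(t, z) ∉ ω 1 := ((mem_lineCls_two_iff t z 1 ω).1 hcls.2).2
    have hK₀ω : ∀ j, K₀ j ⊆ ω 0 := fun j => (h₀ j).trans (offBonds_subset _ _)
    have hK₁ω : ∀ j, K₁ j ⊆ ω 1 := fun j => (h₁ j).trans (offBonds_subset _ _)
    have hb₀K₀ : ∀ j, Disjoint (K₀ j) {s(u, v)} := fun j => Set.disjoint_singleton_right.2 fun h => by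
      have h' := h₀ j h; rw [offBonds_def] at h'; exact h'.2 rfl
    have hb₀K₁ : ∀ j, Disjoint ({s(u, v)} : Set (Sym2 (Site d))) (K₁ j) := fun j =>
      Set.disjoint_singleton_left.2 fun h => by
        have h' := h₁ j h; rw [offBonds_def] at h'
        exact h'.2 ((mem_bondsAt_singleton_iff u _).2 (Sym2.mem_mk_left u v))
    have hK00 : K₀ 0 ∈ (openConn 0 u : Set (BondConfig (Site d))) := hA₀ 0
    have hK01 : K₀ 1 ∈ (openConn 0 w : Set (BondConfig (Site d))) := hA₀ 1
    have hK03 : K₀ 3 ∈ (openConn w z : Set (BondConfig (Site d))) := hA₀ 3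
    have hK10 : K₁ 0 ∈ (openConn v t : Set (BondConfig (Site d))) := hA₁ 0
    have hK11 : K₁ 1 ∈ (openConn t z : Set (BondConfig (Site d))) := hA₁ 1
    have hK12 : K₁ 2 ∈ (openConn t x : Set (BondConfig (Site d))) := hA₁ 2
    have hK13 : K₁ 3 ∈ (openConn z x : Set (BondConfig (Site d))) := hA₁ 3
    have hK03' : K₀ 3 ∈ (openConn z u : Set (BondConfig (Site d))) := by
      rw [hwu]; exact SimpleGraph.Reachable.symm hK03
    refine mem_genDisjOccGrouped_of_pools₃ _ _ _ ω ![K₀ 0, K₀ 1, K₀ 3, {s(u, v)}] ![K₁ 0] ![K₁ 1, K₁ 2, K₁ 3]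
      ?_ ?_ ?_ ?_ ?_ ?_ src02 (by decide) ?_ ?_ (by decide)
    · intro a; fin_cases a
      · exact hK₀ω 0
      · exact hK₀ω 1
      · exact hK₀ω 3
      · exact Set.singleton_subset_iff.2 hb0
    · intro b; fin_cases b; exact hK₁ω 0
    · intro r; fin_cases r
      · exact hK₁ω 1
      · exact hK₁ω 2
      · exact hK₁ω 3
    · exact pairwise_disjoint_vec4 (hd₀ (by decide)) (hd₀ (by decide)) (hb₀K₀ 0) (hd₀ (by decide))
        (hb₀K₀ 1) (hb₀K₀ 3)
    · rintro (b | b) (b' | b') hbb' <;> fin_cases b <;> fin_cases b' <;> simp at hbb' ⊢ <;> exact hd₁ (by decide)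
    · intro a b; fin_cases a <;> fin_cases b
      · exact (hc₀ 0).symm
      · exact (hc₀ 1).symm
      · exact (hc₀ 3).symm
      · exact hb₀K₁ 0
    · rintro (i | i | i) <;> fin_cases i <;> rfl
    · rintro (i | i | i) <;> fin_cases i
      · show K₀ 0 ∈ (event (ge 0) 0 u : Set (BondConfig (Site d)))
        rw [event_ge, openConnGe_zero]; exact hK00
      · show K₀ 1 ∈ (event (ge 0) 0 u : Set (BondConfig (Site d)))
        rw [event_ge, openConnGe_zero, hwu]; exact hK01
      · show K₀ 3 ∈ (event (ge 1) z u : Set (BondConfig (Site d)))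
        rw [event_ge, openConnGe_one_eq hzu]; exact hK03'
      · show ({s(u, v)} : Set (Sym2 (Site d))) ∈ (event (eq 1) u v : Set (BondConfig (Site d)))
        rw [event_eq]; exact mem_openConnEq_one_of_mem huv (Set.mem_singleton _)
      · show K₁ 0 ∈ (event (ge 0) v t : Set (BondConfig (Site d)))
        rw [event_ge, openConnGe_zero]; exact hK10
      · show K₁ 2 ∈ (event (ge 1) x t : Set (BondConfig (Site d)))
        rw [event_ge, openConnGe_one_eq hxt]; exact SimpleGraph.Reachable.symm hK12
      · show K₁ 1 ∈ (event (ge 2) t z : Set (BondConfig (Site d)))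
        rw [event_ge]; exact mem_openConnGe_two_of_notMem hK11 htz fun h => hclosed (hK₁ω 1 h)
      · show K₁ 3 ∈ (event (ge 1) z x : Set (BondConfig (Site d)))
        rw [event_ge, openConnGe_one_eq hzx]; exact hK13
  -- finitary lines
  have hfS : ∀ i, IsFinitary (AS i) := fun i => by
    rw [hAS]; fin_cases i; exacts [isFinitary_event (ge 0) 0 u, isFinitary_event (ge 0) 0 u]
  have hfM : ∀ i, IsFinitary (AM i) := fun i => by
    rw [hAM]; fin_cases i
    exacts [isFinitary_event (ge 1) z u, isFinitary_event (eq 1) u v, isFinitary_event (ge 0) v t]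
  have hfE : ∀ i, IsFinitary (AE i) := fun i => by
    rw [hAE]; fin_cases i
    exacts [isFinitary_event (ge 1) x t, isFinitary_event (ge 2) t z, isFinitary_event (ge 1) z x]
  -- grouped BK and the three letters
  calc piPerc d p 2 ({ω : Fin 2 → BondConfig (Site d) | s(u, v) ∈ ω 0} ∩ F)
      ≤ piPerc d p 2 (genDisjOccGrouped (Sum.elim AS (Sum.elim AM AE)) (Sum.elim cS (Sum.elim cM cE)) tag3) :=
        measure_mono hincl
    _ ≤ piPerc d p 2 (genDisjOcc AS cS) * piPerc d p 2 (genDisjOcc AM cM) * piPerc d p 2 (genDisjOcc AE cE) :=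
        piPerc_genDisjOccGrouped_tag3_le p AS AM AE cS cM cE hfS hfM hfE
    _ ≤ blockPS (Letters.perc d p) 0 u w *
          (kd (w - u) 0 * (Letters.perc d p).T (ge 1) (eq 1) (ge 0) (-(z - u)) (stepVec ι₀ - (z - u))
            (t - u - (z - u))) *
          blockPE (Letters.perc d p) 2 (t - x) (z - x) := by
        refine mul_le_mul' (mul_le_mul' ?_ ?_) ?_
        · rw [← hwu]; exact piPerc_start_zero_le_blockPS p u cS rfl
        · exact piPerc_mid_zero_two_abs_le p hv hwu.symm cM
        · exact piPerc_end_two_le_blockPE p hzx htx cE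

/-! ## B. The `ι`-event -/

namespace IotaCls02Abs

/-- The five upgraded level-`0` lines of part `I` in class `(0,2)` (`w = u`):
`{0 ←3→ e}, {e ↔ u}, {u ↔ u}, {z ←1→ u}, {e ↔ u}` (as `IotaCls02.lines`, level `0`).
[cite: FitznerVanDerHofstad2017, §6.1 "Case a = 0", "Case a = 0 and b = 2" (arXiv:1506.07977v2 p. 59)] -/
def l0 (e u z : Site d) : Fin 5 → Set (BondConfig (Site d)) :=
  ![event (ge 3) 0 e, event (ge 0) e u, event (ge 0) u u, event (ge 1) z u, event (ge 0) e u]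

/-- The five level-`0` lines are finitary. [cite: FitznerVanDerHofstad2017, §4.2 Def. 4.1 (arXiv:1506.07977v2 p. 35)] -/
theorem isFinitary_l0 (e u z : Site d) : ∀ i, IsFinitary (l0 (d := d) e u z i) := by
  intro i; fin_cases i
  exacts [isFinitary_event (ge 3) 0 e, isFinitary_event (ge 0) e u, isFinitary_event (ge 0) u u,
    isFinitary_event (ge 1) z u, isFinitary_event (ge 0) e u]

/-- The ten-line family (five level-`0` lines, the absorbed bond `{u ←1̲→ v}₀`, the four level-`1` lines of class
`b = 2`, `IotaCls22.lv1`). [cite: FitznerVanDerHofstad2017, §6.1 (6.4) and the sentence after it (arXiv:1506.07977v2 p. 58)] -/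
def lines₀ (e u z v t x : Site d) : (Fin 5 ⊕ Fin 1) ⊕ Fin 4 → Set (BondConfig (Site d)) :=
  Sum.elim (Sum.elim (l0 e u z) ![event (eq 1) u v]) (IotaCls22.lv1 v t z x)

/-- The ten lines are finitary. [cite: FitznerVanDerHofstad2017, §4.2 Def. 4.1 (arXiv:1506.07977v2 p. 35)] -/
theorem isFinitary_lines₀ (e u z v t x : Site d) : ∀ i, IsFinitary (lines₀ (d := d) e u z v t x i) := by
  rintro ((i | i) | j)
  · exact isFinitary_l0 e u z i
  · fin_cases i; exact isFinitary_event (eq 1) u v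
  · exact IotaCls22.isFinitary_lv1 v t z x j

end IotaCls02Abs

open IotaCls22 (up₁) in
/-- **[FvdH17] §6.1, class `(a,b) = (0,2)` of (6.4) at `N = 1` for the `ι`-event, with the REPULSIVE middle
letter** (absorbed style: the bond `b₀` is the sixth level-`0` line `{u ←1̲→ v}₀` of the `Ā`-group, grouping `grpιI₀`;
part `II` is empty in class `a = 0`; middle factor written out, see `jointWitIota_cls_zero_two''`).
[cite: FitznerVanDerHofstad2017, §6.1 proof of Lemma 5.3, "Case a = 0, b ≥ 2" (arXiv:1506.07977v2 p. 59)]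
[cite: FitznerVanDerHofstad2017, §6.1 (6.4) and the sentence after it (arXiv:1506.07977v2 p. 58)] -/
theorem jointWitIota_cls_zero_two_abs (ι : Fin d × Bool) (x u v w z t : Site d) :
    ENNReal.ofReal (bondJ d p (v - u)) * piPerc d p 2 (jointWitIota ι x u v w z t ∩ clsSet u w t z 0 2) ≤
      ∑ κ : Fin d × Bool, (if v = u + stepVec κ then (1 : ℝ≥0∞) else 0) *
        (blockPiota (Letters.perc d p) ι 0 u w *
          (kd (w - u) 0 * (Letters.perc d p).T (ge 1) (eq 1) (ge 0) (-(z - u)) (stepVec κ - (z - u)) (t - u - (z - u))) *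
          blockPE (Letters.perc d p) 2 (t - x) (z - x)) := by
  classical
  rw [jointWitIota_inter_eq_of_II (jointWitIotaII_inter_clsSet_zero_eq_empty ι x u v w z t 2)]
  refine ofReal_bondJ_mul_le_sum_ite p u v _ _ fun κ hv => ?_
  by_cases hne : (jointWitIotaI ι x u v w z t ∩ clsSet u w t z 0 2).Nonempty
  swap
  · rw [Set.not_nonempty_iff_eq_empty.1 hne, measure_empty, mul_zero]; exact zero_le
  obtain ⟨ω₀, hω₀⟩ := hne
  have hs : JWιSide u v w z t x := (sideI_of_mem hω₀.1).1
  have hzu : z ≠ u := hs.2.2.2.2.2.1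
  obtain ⟨hzx, htx⟩ := ne_and_ne_of_side_of_mem_lineCls hs (by decide) hω₀.2.2
  have hwu : u = w := (mem_lineCls_zero_iff u w 0 ω₀).1 hω₀.2.1
  have huv : u ≠ v := (adj_of_eq_add_stepVec hv).ne
  subst hwu
  -- absorb `p` as the open bond `b₀` on level `0`
  rw [ofReal_mul_piPerc_eq_inter_of_preimage p hv
    ((measurableSet_jointWitIotaI ι x u v u z t).inter (measurableSet_clsSet u u t z 0 2))
    (eraseAt0_preimage_jointWitIotaI_inter_clsSet ι x u v u z t 0 2)]
  have h3 := piPerc_inter_le_prod₃_of_witnessedι₀ p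
    (E := jointWitIotaI ι x u v u z t) (C := clsSet u u t z 0 2)
    (fun ω (hω : ω ∈ jointWitIotaI ι x u v u z t) => hω.2.2)
    (IotaCls02Abs.lines₀ (stepVec ι) u z v t x) (IotaCls02Abs.isFinitary_lines₀ _ u z v t x) grpιI₀ grpιI₀_adm
    (fun ω _ hlat i K hK _ hL hI _ => by
      fin_cases i
      · exact mem_event_ge_three_zero_stepVec hlat hK hL (hI (by decide))
      · exact mem_openConnGe_zero_of_mem hL
      · exact mem_openConnGe_zero_of_mem hL
      · have hL' : K ∈ (openConn u z : Set (BondConfig (Site d))) := hL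
        exact mem_openConnGe_one_of_ne (SimpleGraph.Reachable.symm hL') hzu
      · exact mem_openConnGe_zero_of_mem hL)
    (mem_openConnEq_one_of_mem huv (Set.mem_singleton _)) (up₁ hzx htx)
  refine h3.trans (mul_le_mul' (mul_le_mul' ?_ ?_) ?_)
  · exact piPerc_grp_le _ _ _ 0 ![Sum.inl (Sum.inl 0), Sum.inl (Sum.inl 1), Sum.inl (Sum.inl 4)] (by decide)
      (by decide) (by funext m; fin_cases m <;> rfl) (piPerc_iotaStart_zero_le_blockPiota p ι u _ rfl)
  · exact piPerc_grp_le _ _ _ 1 ![Sum.inl (Sum.inl 3), Sum.inl (Sum.inr 0), Sum.inr 0] (by decide) (by decide)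
      (by funext m; fin_cases m <;> rfl) (piPerc_mid_zero_two_abs_le p hv rfl _)
  · exact piPerc_grp_le _ _ _ 2 ![Sum.inr 2, Sum.inr 1, Sum.inr 3] (by decide) (by decide)
      (by funext m; fin_cases m <;> rfl) (piPerc_end_two_le_blockPE p hzx htx _)

/-! ## C. Against `Ā''` -/

/-- **Case `a = 0, b ≥ 2` against `Ā''`** (twin of `NobleBoundsN1ClassTools.piPerc_mid_zero_two_le_blockAbar'`, same line
order): `ℙ^{⊗2}({u ←1̲→ v} ⊛ {v ←0→ t} ⊛ {z ←1→ u}) ≤ Ā''^{ι,0,2}(u,u,t,z) = 𝓣_{1,1̲,0}(u−z, v−z, t−z)`.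
[cite: FitznerVanDerHofstad2017, §6.1 proof of Lemma 5.3, "Case a = 0, b ≥ 2" (arXiv:1506.07977v2 p. 59)] -/
theorem piPerc_mid_zero_two_le_blockAbar'' {ι : Fin d × Bool} {u v w t z : Site d} (hv : v = u + stepVec ι)
    (hw : w = u) (c : Fin 3 → Fin 2) :
    piPerc d p 2 (genDisjOcc ![event (eq 1) u v, event (ge 0) v t, event (ge 1) z u] c) ≤
      blockAbar'' (Letters.perc d p) ι 0 2 u w t z := by
  subst hw
  rw [blockAbar''_zero_two_eq (Letters.perc d p) ι hv]
  refine (measure_mono (genDisjOcc_subset_reindex ![2, 0, 1] (by decide) _ c)).trans ?_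
  have hA : (fun i => (![event (eq 1) w v, event (ge 0) v t, event (ge 1) z w] : Fin 3 → Set (BondConfig (Site d)))
      ((![2, 0, 1] : Fin 3 → Fin 3) i)) = ![event (ge 1) z w, event (eq 1) w v, event (ge 0) v t] := by
    funext i; fin_cases i <;> rfl
  rw [hA]
  exact piPerc_two_genDisjOcc_le_T p (ge 1) (eq 1) (ge 0) z w v t _

/-- **[FvdH17] §6.1, class `(a,b) = (0,2)` of (6.4) at `N = 1` against `Ā''`**:
`J(v−u) ℙ_p^{⊗2}(jointWit u v w z t x ∩ class (0,2)) ≤ Σ_ι 𝟙{v = u+e_ι} P^{S,0}(u,w) Ā''^{ι,0,2}(u,w,t,z) P^{E,2}(t−x,z−x)`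
(the twin of `NobleBoundsN1Cls02.jointWit_cls_zero_two` with the repulsive middle letter).
[cite: FitznerVanDerHofstad2017, §6.1 proof of Lemma 5.3, "Case a = 0, b ≥ 2" (arXiv:1506.07977v2 p. 59)]
[cite: FitznerVanDerHofstad2017, §6.1 (6.4) and the sentence after it (arXiv:1506.07977v2 p. 58)] -/
theorem jointWit_cls_zero_two'' (x u v w z t : Site d) :
    ENNReal.ofReal (bondJ d p (v - u)) * piPerc d p 2 (jointWit u v w z t x ∩ clsSet u w t z 0 2) ≤
      ∑ ι : Fin d × Bool, (if v = u + stepVec ι then (1 : ℝ≥0∞) else 0) *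
        (blockPS (Letters.perc d p) 0 u w * blockAbar'' (Letters.perc d p) ι 0 2 u w t z *
          blockPE (Letters.perc d p) 2 (t - x) (z - x)) := by
  simp_rw [blockAbar''_zero_two]
  exact jointWit_cls_zero_two_abs p x u v w z t

/-- **[FvdH17] §6.1, class `(a,b) = (0,2)` of (6.4) at `N = 1` for the `ι`-event against `Ā''`**
(the twin of `NobleBoundsN1IotaCls02.jointWitIota_cls_zero_two` with the repulsive middle letter).
[cite: FitznerVanDerHofstad2017, §6.1 proof of Lemma 5.3, "Case a = 0, b ≥ 2" (arXiv:1506.07977v2 p. 59)]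
[cite: FitznerVanDerHofstad2017, §6.1 (6.4) and the sentence after it (arXiv:1506.07977v2 p. 58)] -/
theorem jointWitIota_cls_zero_two'' (ι : Fin d × Bool) (x u v w z t : Site d) :
    ENNReal.ofReal (bondJ d p (v - u)) * piPerc d p 2 (jointWitIota ι x u v w z t ∩ clsSet u w t z 0 2) ≤
      ∑ κ : Fin d × Bool, (if v = u + stepVec κ then (1 : ℝ≥0∞) else 0) *
        (blockPiota (Letters.perc d p) ι 0 u w * blockAbar'' (Letters.perc d p) κ 0 2 u w t z *
          blockPE (Letters.perc d p) 2 (t - x) (z - x)) := by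
  simp_rw [blockAbar''_zero_two]
  exact jointWitIota_cls_zero_two_abs p ι x u v w z t

end Literature.Probability.FitznerVanDerHofstad2017

end
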